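import Literature.Topology.FourManifolds.DiscCollarNormalisation
import Literature.Topology.FourManifolds.SmaleDiffDisc
import HarnessLib

/-!
# `Diff⁺(D²)` is connected, in ambient-germ form

Topic `Literature/Topology/FourManifolds` (programme of the fact
`Literature.Topology.FourManifolds.cerf_pi0DiffDisc_relBoundary_three`, brick C3a = Cerf, Ch. IV §3, Propriété 3 for the faces of the
models; Smale 1959).  **Theorem** (`isoRel_id_of_germ`): an embedding germ `d` of the closed
unit disc `𝔻² ⊂ ℝ²` onto itself with positive Jacobian is the end of a self-isotopy of `𝔻²`:
there is a jointly smooth family `K_t` of embedding germs of `𝔻²` onto itself with `K₀ = id`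
and `K₁ = d` on `𝔻²` (`PiecePar.IsoRel (𝔻 2) id d`).

Proof (Hirsch, Ch. 8 §3 with Smale's theorem):
1. `d = Θ₁ ∘ d₁` with `Θ` the ambient realisation of the boundary diffeotopy and `d₁` fixing the
   circle pointwise (`DiscIsotopyExtension.exists_factor_fixing_sphere`);
2. `d₁ ∼ f₂` with `f₂ = id` on a collar of the circle (`DiscCollarNormalisation`);
3. `f₂` extended by the identity is a diffeomorphism of `ℝ²` equal to `id` off the open disc,
   hence diffeotopic to `id` through such diffeomorphisms by Smale's theorem in the tree's form
   `unitBallDiffeotopyTrivial_euclideanSpace_two` (`SmaleDiffDisc.lean`); these stages preserve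
   `𝔻²`, so `id ∼ f₂`;
4. compose: `id ∼ f₂ ∼ d₁`, and `K_t := Θ_t ∘ K'_t` ends at `Θ₁ ∘ d₁ = d`.

## References
* [Smale1959] S. Smale, *Diffeomorphisms of the 2-sphere*, Proc. AMS 10 (1959), 621–626, Thm. B.
* [HirschDT1976] M. W. Hirsch, *Differential Topology*, GTM 33 (1976), Ch. 8 §3, Thm. 3.3 ff.
* [CerfDiffeoSphere1968] J. Cerf, LNM 53 (1968), Ch. IV §3, Propriété 3.
-/

noncomputable section

open Set Function Filter Topology Metric
open scoped ContDiff Manifold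

namespace Literature.Topology.FourManifolds

/-- Local notation: `𝔼 n` is the model Euclidean space `EuclideanSpace ℝ (Fin n)`. -/
local notation "𝔼 " n:arg => EuclideanSpace ℝ (Fin n)
/-- Local notation: `𝔻 n` is the closed unit ball in `EuclideanSpace ℝ (Fin n)`. -/
local notation "𝔻 " n:arg => (Metric.closedBall (0 : EuclideanSpace ℝ (Fin n)) 1)

namespace DiscDiffeoIsotopy

variable {k : ℕ}

/-! ### Extension by the identity of a germ which is the identity near the sphere -/

/-- **Extension by the identity.**  An embedding germ `f₂` of the closed unit ball onto itself
which is the identity on a collar `{1 - δ < ‖x‖ ≤ 1}` extends by the identity to a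
diffeomorphism `s` of `ℝᵏ⁺¹` with `s = f₂` on the ball and `s = id` off the open ball.
[folklore] -/
theorem exists_diffeomorph_extend {f₂ : 𝔼 (k + 1) → 𝔼 (k + 1)}
    (hf : IsEmbGerm (𝔻 (k + 1)) f₂) (himg : f₂ '' (𝔻 (k + 1)) = 𝔻 (k + 1)) {δ : ℝ} (hδ : 0 < δ)
    (hcol : ∀ x ∈ 𝔻 (k + 1), 1 - δ < ‖x‖ → f₂ x = x) :
    ∃ s : 𝔼 (k + 1) ≃ₘ⟮𝓘(ℝ, 𝔼 (k + 1)), 𝓘(ℝ, 𝔼 (k + 1))⟯ 𝔼 (k + 1),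
      (∀ x ∈ 𝔻 (k + 1), s x = f₂ x) ∧ ∀ y : 𝔼 (k + 1), 1 ≤ ‖y‖ → s y = y := by
  classical
  obtain ⟨g, hgs, hleft, -, -⟩ := hf.exists_inverse (isCompact_closedBall 0 1)
  have hl : ∀ x ∈ 𝔻 (k + 1), g (f₂ x) = x := fun x hx =>
    (hleft.filter_mono (nhds_le_nhdsSet hx)).self_of_nhds
  have hfD : ∀ x ∈ 𝔻 (k + 1), f₂ x ∈ 𝔻 (k + 1) := fun x hx => by
    rw [← himg]; exact mem_image_of_mem _ hx
  have hgD : ∀ y ∈ 𝔻 (k + 1), g y ∈ 𝔻 (k + 1) ∧ f₂ (g y) = y := fun y hy => by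
    obtain ⟨x, hx, rfl⟩ : y ∈ f₂ '' (𝔻 (k + 1)) := by rw [himg]; exact hy
    rw [hl x hx]; exact ⟨hx, rfl⟩
  -- the extended map and its inverse
  set d₃ : 𝔼 (k + 1) → 𝔼 (k + 1) := fun x => if ‖x‖ ≤ 1 then f₂ x else x with hd₃
  set e : 𝔼 (k + 1) → 𝔼 (k + 1) := fun y => if ‖y‖ ≤ 1 then g y else y with he
  have hd₃D : ∀ x ∈ 𝔻 (k + 1), d₃ x = f₂ x := fun x hx => by
    simp only [hd₃, if_pos (mem_closedBall_zero_iff.1 hx)]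
  have hd₃col : ∀ x : 𝔼 (k + 1), 1 - δ < ‖x‖ → d₃ x = x := fun x hx => by
    by_cases h1 : ‖x‖ ≤ 1
    · simp only [hd₃, if_pos h1]; exact hcol x (mem_closedBall_zero_iff.2 h1) hx
    · simp only [hd₃, if_neg h1]
  have hecol : ∀ y : 𝔼 (k + 1), 1 - δ < ‖y‖ → e y = y := fun y hy => by
    by_cases h1 : ‖y‖ ≤ 1
    · simp only [he, if_pos h1]
      have hyD : y ∈ 𝔻 (k + 1) := mem_closedBall_zero_iff.2 h1
      conv_lhs => rw [← hcol y hyD hy]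
      exact hl y hyD
    · simp only [he, if_neg h1]
  -- smoothness: `f₂`/`g` on the open ball, the identity on `{1 - δ < ‖·‖}`
  have hsmooth : ∀ {φ ψ : 𝔼 (k + 1) → 𝔼 (k + 1)}, ContDiff ℝ ∞ ψ →
      (∀ x : 𝔼 (k + 1), ‖x‖ ≤ 1 → φ x = ψ x) → (∀ x : 𝔼 (k + 1), 1 - δ < ‖x‖ → φ x = x) →
      ContDiff ℝ ∞ φ := by
    intro φ ψ hψ hball hout
    refine contDiff_iff_contDiffAt.2 fun x => ?_
    by_cases hx : ‖x‖ < 1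
    · have hev : φ =ᶠ[𝓝 x] ψ := by
        filter_upwards [(isOpen_lt continuous_norm continuous_const).mem_nhds hx] with y hy
        exact hball y hy.le
      exact hψ.contDiffAt.congr_of_eventuallyEq hev
    · have hx' : 1 - δ < ‖x‖ := by linarith [not_lt.1 hx]
      have hev : φ =ᶠ[𝓝 x] id := by
        filter_upwards [(isOpen_lt continuous_const continuous_norm).mem_nhds hx'] with y hy
        exact hout y hy
      exact contDiffAt_id.congr_of_eventuallyEq hev
  have hd₃s : ContDiff ℝ ∞ d₃ :=
    hsmooth hf.contDiff (fun x hx => by simp only [hd₃, if_pos hx]) hd₃col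
  have hes : ContDiff ℝ ∞ e := hsmooth hgs (fun x hx => by simp only [he, if_pos hx]) hecol
  have hleft' : ∀ x, e (d₃ x) = x := fun x => by
    by_cases h1 : ‖x‖ ≤ 1
    · have hxD : x ∈ 𝔻 (k + 1) := mem_closedBall_zero_iff.2 h1
      simp only [hd₃, if_pos h1, he, if_pos (mem_closedBall_zero_iff.1 (hfD x hxD))]
      exact hl x hxD
    · simp only [hd₃, he, if_neg h1]
  have hright' : ∀ y, d₃ (e y) = y := fun y => by
    by_cases h1 : ‖y‖ ≤ 1
    · have hyD : y ∈ 𝔻 (k + 1) := mem_closedBall_zero_iff.2 h1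
      obtain ⟨hgy, hfg⟩ := hgD y hyD
      simp only [he, if_pos h1, hd₃, if_pos (mem_closedBall_zero_iff.1 hgy)]
      exact hfg
    · simp only [he, hd₃, if_neg h1]
  refine ⟨⟨⟨d₃, e, hleft', hright'⟩, contMDiff_iff_contDiff.2 hd₃s, contMDiff_iff_contDiff.2 hes⟩,
    hd₃D, fun y hy => hd₃col y (by linarith)⟩

/-! ### Diffeotopies fixing the exterior are self-isotopies of the ball -/

/-- A diffeotopy of `ℝᵏ⁺¹` whose stages fix every point off the open unit ball is a
self-isotopy of the closed unit ball. [folklore] -/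
theorem isSelfIsotopy_of_diffeotopy (D : Diffeotopy 𝓘(ℝ, 𝔼 (k + 1)) (𝔼 (k + 1)))
    (hfix : ∀ (t : ℝ) (y : 𝔼 (k + 1)), 1 ≤ ‖y‖ → D.toFun t y = y) :
    IsSelfIsotopy (𝔻 (k + 1)) D.toFun := by
  set A : AmbientIsotopy (𝓡 (k + 1)) (𝔼 (k + 1)) := D.toAmbientIsotopy with hA
  have hAD : A.toFun = D.toFun := D.toAmbientIsotopy_toFun
  have hbij : ∀ t, Bijective (D.toFun t) := fun t => hAD ▸ A.bijective t
  refine ⟨hAD ▸ A.contDiff_uncurry_toFun, fun t _ => hAD ▸ A.isEmbGerm_stage _ t,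
    fun t _ => ?_, fun x _ => by rw [D.toFun_zero]; rfl⟩
  apply Subset.antisymm
  · rintro _ ⟨x, hx, rfl⟩
    by_contra hout
    have h1 : 1 ≤ ‖D.toFun t x‖ := by
      by_contra h; exact hout (mem_closedBall_zero_iff.2 (not_le.1 h).le)
    have h2 : D.toFun t (D.toFun t x) = D.toFun t x := hfix t _ h1
    have h3 : D.toFun t x = x := (hbij t).injective h2
    rw [h3] at hout
    exact hout hx
  · intro y hy
    obtain ⟨x, rfl⟩ := (hbij t).surjective y
    refine ⟨x, ?_, rfl⟩
    by_contra hout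
    have h1 : 1 ≤ ‖x‖ := by
      by_contra h; exact hout (mem_closedBall_zero_iff.2 (not_le.1 h).le)
    rw [hfix t x h1] at hy
    exact hout hy

/-! ### The theorem -/

/-- **`Diff⁺(D²)` is connected (ambient-germ form).**  An orientation-preserving embedding germ
of the closed unit disc onto itself is the end of a self-isotopy of the disc:
`IsoRel (𝔻 2) id d`. [cite: Smale1959, Thm. B] [cite: HirschDT1976, Ch. 8 §3]
[cite: CerfDiffeoSphere1968, Ch. IV §3, Propriété 3] -/
theorem isoRel_id_of_germ {d : 𝔼 2 → 𝔼 2} (hd : IsEmbGerm (𝔻 2) d) (himg : d '' (𝔻 2) = 𝔻 2)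
    (hdet : ∀ x ∈ 𝔻 2, 0 < LinearMap.det (fderiv ℝ d x : 𝔼 2 →ₗ[ℝ] 𝔼 2)) :
    IsoRel (𝔻 2) id d := by
  -- 1. factor `d = Θ₁ ∘ d₁` with `d₁` fixing the circle pointwise
  obtain ⟨Θ, d₁, hΘ, hd₁, hd₁img, -, hd₁fix, hfac⟩ := exists_factor_fixing_sphere hd himg hdet
  -- 2. collar normalisation of `d₁`
  obtain ⟨f₂, hrel, hf₂, hf₂img, δ, hδ, hcol⟩ :=
    CollarNormalisation.exists_isoRel_eq_id_near_sphere hd₁ hd₁img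
      (fun x hx => hd₁fix x (mem_sphere_zero_iff_norm.2 hx))
  -- 3. extend `f₂` by the identity and apply Smale's theorem
  obtain ⟨s, hsD, hsfix⟩ := exists_diffeomorph_extend hf₂ hf₂img hδ hcol
  obtain ⟨D, hD1, hDfix⟩ := unitBallDiffeotopyTrivial_euclideanSpace_two s hsfix
  have hDself : IsSelfIsotopy (𝔻 2) D.toFun := isSelfIsotopy_of_diffeotopy D hDfix
  have h3 : IsoRel (𝔻 2) id f₂ := by
    refine ⟨D.toFun, hDself, fun x hx => ?_⟩
    rw [id, ← Diffeotopy.coe_stage, hD1, hsD x hx]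
  -- 4. assemble: `id ∼ f₂ ∼ d₁`, then compose with `Θ`
  have h4 : IsoRel (𝔻 2) id d₁ := h3.trans (hrel.symm (isCompact_closedBall 0 1))
  obtain ⟨K', hK', hK'1⟩ := h4
  refine ⟨fun t x => Θ t (K' t x), hΘ.comp hK', fun x hx => ?_⟩
  rw [id, ← hfac x hx, hK'1 x hx, id]

end DiscDiffeoIsotopy

end Literature.Topology.FourManifolds
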